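import Mathlib
import HarnessLib
import Literature.NumberTheory.LFunctions.ZetaScrew
import Summits.RiemannHypothesis.RiemannHypothesis.Theorems.IntegerScrewRung128
import Summits.RiemannHypothesis.RiemannHypothesis.Theorems.MotivicDoorSemilocalClosed
import Summits.RiemannHypothesis.RiemannHypothesis.Theorems.WeilFormatCDataA1RungCB
import Summits.RiemannHypothesis.RiemannHypothesis.Theorems.IntegerScrewTopBlockNegHead
import Summits.RiemannHypothesis.RiemannHypothesis.Theorems.DbrLatticeAntipersistence
import Summits.RiemannHypothesis.RiemannHypothesis.Theorems.DbrWallLogTableA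
import Summits.RiemannHypothesis.RiemannHypothesis.Theorems.InventoryDeletionBlindnessDetThree

/-!
# W-06 cycle 5, cell C4⁵ (T) «DELETION-UNIFORM TRANSFERS» — Single-deletion bump law + detection p = 5, 7

The SINGLE-DELETION BUMP LAW (uniform in the prime `p`) and kernel pins at `p = 5, 7`.

For `D = {p}` at level `M = p + 1`, the kept Gram matrix differs from ζ's by a RANK-2 BUMP at the top node:
`S_{p+1}(ζ_{ℙ∖{p}}) = S_{p+1}(ζ) + φ_p (e_top 1ᵀ + 1 e_topᵀ)`, `φ_p = (log p/√p)(log(p+1) − log p)`.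

Kernel instances: `p = 5` with witness `x = (1,1,3,1,−3)`, `p = 7` with witness `x = (1,1,0,0,2,0,−2)`.

TEST 0: both sides are finite rungs; 0 bits toward `Re ρ(ζ)`. Nothing here bears on the truth of RH.
-/

set_option linter.dupNamespace false

namespace RhIdea6.G14.Transfer

open Literature.NumberTheory.LFunctions Finset
open Summit.RiemannHypothesis.RiemannHypothesis.Theorems.IntegerScrew
open Literature.Analysis.ValidatedNumerics Literature.Analysis.ValidatedNumerics.Numerics
open Summit.RiemannHypothesis.RiemannHypothesis.Theorems.IntegerScrew.RungCert
open Summit.RiemannHypothesis.RiemannHypothesis.Theorems.IntegerScrew.TopBlockNeg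
open Summit.RiemannHypothesis.RiemannHypothesis.Theorems.DbrLattice
open Summit.RiemannHypothesis.RiemannHypothesis.Theorems.DbrWall.LogTable (log_two_bounds log_three_bounds log_five_bounds log_seven_bounds)
open scoped BigOperators

/-! ## §8. The SINGLE-DELETION BUMP LAW (uniform in the prime `p`) and the kernel pin at `p = 5`

For `D = {p}` at level `M = p + 1` (nodes `log 2, …, log(p+1)`), the kept Gram matrix differs from ζ's by a
RANK-2 BUMP at the top node only: `S_{p+1}(ζ_{ℙ∖{p}}) = S_{p+1}(ζ) + φ_p (e_top 1ᵀ + 1 e_topᵀ)`,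
`φ_p = (log p/√p)(log(p+1) − log p)` — every other node value and every difference `log(m/m')`
(`m/m' ≤ (p+1)/2 < p`) is untouched (`deletedHinge_singleton`).  Hence
`Q_D(x) = Q_ζ(x) + 2 φ_p · x_top · Σ_i x_i`, and DETECTION at `M₀ = p + 1` is the statement that `S_{p+1}(ζ)` does
not dominate this bump.  Kernel instance `p = 5`: `x = (1,1,3,1,−3)`, `Q_D(x) ≈ 2.0935 − 18 φ₅ ≈ −0.2686 < 0`. -/

/-- The bump weight `φ_p = (Λ(p)/√p)(log(p+1) − log p)`. [folklore] -/
noncomputable def bumpWeight (p : ℕ) : ℝ :=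
  (ArithmeticFunction.vonMangoldt p : ℝ) / Real.sqrt p * (Real.log ((p : ℝ) + 1) - Real.log p)

/-- Below `2p` a single deleted prime `p` contributes through the power `p` only. [folklore] -/
theorem deletedHinge_singleton {p : ℕ} (hp : p.Prime) {t : ℝ} (hN : ⌊Real.exp |t|⌋₊ < 2 * p) :
    deletedHinge {p} t =
      if p ≤ ⌊Real.exp |t|⌋₊ then
        (ArithmeticFunction.vonMangoldt p : ℝ) / Real.sqrt p * (|t| - Real.log p)
      else 0 := by
  unfold deletedHinge
  have key : ∀ n ∈ Icc 1 ⌊Real.exp |t|⌋₊, n ≠ p →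
      (if n.minFac ∈ ({p} : Finset ℕ) then
        (ArithmeticFunction.vonMangoldt n : ℝ) / Real.sqrt n * (|t| - Real.log n) else 0) = 0 := by
    intro n hn hnp
    rw [Finset.mem_Icc] at hn
    rw [if_neg]
    rw [Finset.mem_singleton]
    intro hmin
    have hdvd : p ∣ n := hmin ▸ Nat.minFac_dvd n
    obtain ⟨k, rfl⟩ := hdvd
    rcases k with _ | _ | k
    · simp at hn
    · simp at hnp
    · have h2 : 2 * p ≤ p * (k + 1 + 1) := by nlinarith
      omega
  split_ifs with hle
  · rw [Finset.sum_eq_single_of_mem p (Finset.mem_Icc.mpr ⟨hp.one_lt.le, hle⟩)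
      (fun n hn hnp ↦ key n hn hnp), if_pos (by rw [Finset.mem_singleton, hp.minFac_eq])]
  · refine Finset.sum_eq_zero fun n hn ↦ ?_
    by_cases hnp : n = p
    · subst hnp; exact absurd (Finset.mem_Icc.mp hn).2 hle
    · exact key n hn hnp

/-- Node values under a single deletion: only the top node `log(p+1)` moves, by `φ_p`. [folklore] -/
theorem keptScrew_singleton_log_nat {p : ℕ} (hp : p.Prime) {m : ℕ} (hm1 : 1 ≤ m) (hm : m ≤ p + 1) :
    keptScrew {p} (Real.log m) = zetaScrew (Real.log m) + if m = p + 1 then bumpWeight p else 0 := by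
  have hm0 : (0 : ℝ) < m := by exact_mod_cast hm1
  have habs : |Real.log (m : ℝ)| = Real.log m :=
    abs_of_nonneg (Real.log_nonneg (by exact_mod_cast hm1))
  have hfl : ⌊Real.exp |Real.log (m : ℝ)|⌋₊ = m := by rw [habs, Real.exp_log hm0, Nat.floor_natCast]
  have h2p : ⌊Real.exp |Real.log (m : ℝ)|⌋₊ < 2 * p := by rw [hfl]; have := hp.two_le; omega
  rw [keptScrew, deletedHinge_singleton hp h2p, hfl, habs]
  by_cases htop : m = p + 1
  · subst htop
    rw [if_pos (by omega), if_pos rfl, bumpWeight]; push_cast; ring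
  · rw [if_neg htop]
    by_cases hpm : p ≤ m
    · have hmp : m = p := by omega
      subst hmp
      rw [if_pos le_rfl]; ring
    · rw [if_neg hpm]

/-- Differences of nodes are untouched by a single deletion (`e^{|log a − log b|} ≤ (p+1)/2 < p`). [folklore] -/
theorem keptScrew_singleton_log_sub {p : ℕ} (hp : p.Prime) {a b : ℕ} (ha : 2 ≤ a) (hb : 2 ≤ b)
    (hap : a ≤ p + 1) (hbp : b ≤ p + 1) :
    keptScrew {p} (Real.log a - Real.log b) = zetaScrew (Real.log a - Real.log b) := by
  wlog hle : b ≤ a generalizing a b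
  · have h := this hb ha hbp hap (by omega)
    rw [show Real.log a - Real.log b = -(Real.log b - Real.log a) by ring, keptScrew_neg, zetaScrew_neg, h]
  have ha0 : (0 : ℝ) < a := by exact_mod_cast (by omega : 0 < a)
  have hb0 : (0 : ℝ) < b := by exact_mod_cast (by omega : 0 < b)
  have hlog : Real.log b ≤ Real.log a := Real.log_le_log hb0 (by exact_mod_cast hle)
  have hexp : Real.exp |Real.log (a : ℝ) - Real.log b| = a / b := by
    rw [abs_of_nonneg (by linarith), ← Real.log_div ha0.ne' hb0.ne', Real.exp_log (div_pos ha0 hb0)]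
  have hfl : ⌊Real.exp |Real.log (a : ℝ) - Real.log b|⌋₊ < p := by
    rw [hexp, Nat.floor_lt (div_pos ha0 hb0).le, div_lt_iff₀ hb0]
    have h1 : (a : ℝ) ≤ p + 1 := by exact_mod_cast hap
    have hb2 : (2 : ℝ) ≤ b := by exact_mod_cast hb
    have hp2 : (2 : ℝ) ≤ p := by exact_mod_cast hp.two_le
    nlinarith
  rw [keptScrew, deletedHinge_singleton hp (by omega), if_neg (by omega), add_zero]

/-- **BUMP LAW (entries):** `S_{p+1}(ζ_{ℙ∖{p}})_{ij} = S_{p+1}(ζ)_{ij} + φ_p([i = top] + [j = top])`. [folklore] -/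
theorem keptScrewMatrix_singleton_apply {p : ℕ} (hp : p.Prime) (i j : Fin p) :
    keptScrewMatrix {p} p i j = screwMatrix p i j
      + (if (i : ℕ) + 1 = p then bumpWeight p else 0) + (if (j : ℕ) + 1 = p then bumpWeight p else 0) := by
  rw [screwMatrix_apply, zetaScrewKernel_def]
  simp only [keptScrewMatrix, Matrix.of_apply]
  have hi := i.isLt
  have hj := j.isLt
  rw [keptScrew_singleton_log_nat hp (m := (i : ℕ) + 2) (by omega) (by omega),
    keptScrew_singleton_log_nat hp (m := (j : ℕ) + 2) (by omega) (by omega),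
    keptScrew_singleton_log_sub hp (a := (i : ℕ) + 2) (b := (j : ℕ) + 2) (by omega) (by omega) (by omega)
      (by omega)]
  by_cases hi' : (i : ℕ) + 1 = p <;> by_cases hj' : (j : ℕ) + 1 = p <;>
    simp [hi', hj', show ((i : ℕ) + 2 = p + 1) ↔ ((i : ℕ) + 1 = p) by omega,
      show ((j : ℕ) + 2 = p + 1) ↔ ((j : ℕ) + 1 = p) by omega] <;> ring

/-- **BUMP LAW (quadratic form):** `Q_D(x) = Q_ζ(x) + 2 φ_p x_top Σ_i x_i`. [folklore] -/
theorem keptScrewMatrix_singleton_quadForm {p : ℕ} (hp : p.Prime) (x : Fin p → ℝ) :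
    dotProduct x ((keptScrewMatrix {p} p).mulVec x) =
      dotProduct x ((screwMatrix p).mulVec x)
        + 2 * bumpWeight p * (∑ i : Fin p, if (i : ℕ) + 1 = p then x i else 0) * ∑ i : Fin p, x i := by
  set b : Fin p → ℝ := fun i ↦ if (i : ℕ) + 1 = p then bumpWeight p else 0 with hb
  have happly : ∀ i j : Fin p, keptScrewMatrix {p} p i j = screwMatrix p i j + b i + b j := by
    intro i j; rw [keptScrewMatrix_singleton_apply hp]
  have hbx : ∀ i : Fin p, b i * x i = bumpWeight p * (if (i : ℕ) + 1 = p then x i else 0) := by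
    intro i; simp only [hb]; split_ifs <;> ring
  have hsum_bx : ∑ i : Fin p, b i * x i = bumpWeight p * ∑ i : Fin p, (if (i : ℕ) + 1 = p then x i else 0) := by
    rw [Finset.mul_sum]; exact Finset.sum_congr rfl fun i _ ↦ hbx i
  simp only [dotProduct, Matrix.mulVec]
  have e : ∀ i : Fin p, x i * ∑ j : Fin p, keptScrewMatrix {p} p i j * x j
      = x i * ∑ j : Fin p, screwMatrix p i j * x j
        + (b i * x i) * ∑ j : Fin p, x j + x i * ∑ j : Fin p, b j * x j := by
    intro i
    simp only [happly, add_mul, Finset.sum_add_distrib, mul_add, Finset.mul_sum]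
    ring_nf
  simp only [e, Finset.sum_add_distrib, ← Finset.sum_mul, hsum_bx]
  ring

/-- `φ₅ = (log 5/√5)(log 6 − log 5) ≥ 0.13122`. [folklore] -/
theorem bumpWeight_five_lower : (0.13122 : ℝ) ≤ bumpWeight 5 := by
  have hl2 := Real.log_two_gt_d9
  obtain ⟨hl3, _⟩ := log_three_bounds
  obtain ⟨hl5, hl5'⟩ := log_five_bounds
  have hΛ : (ArithmeticFunction.vonMangoldt 5 : ℝ) = Real.log 5 := by
    rw [ArithmeticFunction.vonMangoldt_apply_prime (by norm_num)]; norm_num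
  have h6 : Real.log ((5 : ℕ) + 1 : ℝ) = Real.log 2 + Real.log 3 := by
    rw [show ((5 : ℕ) + 1 : ℝ) = 2 * 3 by norm_num, Real.log_mul (by norm_num) (by norm_num)]
  rw [bumpWeight, hΛ, h6]
  push_cast
  set s := Real.sqrt 5 with hs
  have hs2 : s ^ 2 = 5 := Real.sq_sqrt (by norm_num)
  have hs0 : 0 < s := Real.sqrt_pos.mpr (by norm_num)
  have hshi : s < (2.2360681 : ℝ) := by nlinarith
  rw [div_mul_eq_mul_div, le_div_iff₀ hs0]
  have hA : 0 ≤ (Real.log 5 - 1.6094379124340) * (Real.log 2 + Real.log 3 - Real.log 5 - 0.18232155) :=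
    mul_nonneg (by linarith) (by linarith)
  nlinarith

/-- ζ's part of the form at `x = (1,1,3,1,−3)` on the nodes `log 2 … log 6`, in table coordinates. [folklore] -/
theorem screwMatrix_five_quadForm :
    dotProduct ![(1 : ℝ), 1, 3, 1, -3] ((screwMatrix 5).mulVec ![1, 1, 3, 1, -3]) =
      15 / 2 * lerchC + 6 * uR 2 1 + 6 * uR 3 1 + 18 * uR 4 1 + 6 * uR 5 1 - 18 * uR 6 1
        - 2 * (uR 3 2 + 3 * uR 4 2 + uR 5 2 - 3 * uR 6 2 + 3 * uR 4 3 + uR 5 3 - 3 * uR 6 3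
          + 3 * uR 5 4 - 9 * uR 6 4 - 3 * uR 6 5) := by
  rw [screwMatrix_eq_tMat]
  simp [dotProduct, Matrix.mulVec, Fin.sum_univ_five, tMat, Matrix.of_apply]
  norm_num
  ring

/-- The kernel decision for `p = 5`, witness `(1,1,3,1,−3)` (ℚ, scale `SC`; `φ₅ ≥ 0.13122`). [folklore] -/
theorem witness5CheckQ :
    15 / 2 * (cHiQ * (SC : ℚ)) + 6 * ((ug utab127 2 1).hi : ℚ) + 6 * ((ug utab127 3 1).hi : ℚ)
      + 18 * ((ug utab127 4 1).hi : ℚ) + 6 * ((ug utab127 5 1).hi : ℚ) - 18 * ((ug utab127 6 1).lo : ℚ)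
      - 2 * (((ug utab127 3 2).lo : ℚ) + 3 * ((ug utab127 4 2).lo : ℚ) + ((ug utab127 5 2).lo : ℚ)
          - 3 * ((ug utab127 6 2).hi : ℚ) + 3 * ((ug utab127 4 3).lo : ℚ) + ((ug utab127 5 3).lo : ℚ)
          - 3 * ((ug utab127 6 3).hi : ℚ) + 3 * ((ug utab127 5 4).lo : ℚ) - 9 * ((ug utab127 6 4).hi : ℚ)
          - 3 * ((ug utab127 6 5).hi : ℚ))
      - 18 * (13122 * (SC : ℚ) / 100000) < 0 := by
  decide +kernel

/-- **DETECTION AT THE FLOOR `p₁ = 5` (RH-FREE certified inequality):** `S_6(ζ_{ℙ∖{5}})` takes the value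
`≈ −0.2686` at `x = (1,1,3,1,−3)`; `M₀(ℙ∖{5}) = 6`. [folklore] -/
theorem keptScrewMatrix_five_not_posSemidef : ¬ (keptScrewMatrix {5} 5).PosSemidef := by
  intro hM
  have hq := hM.dotProduct_mulVec_nonneg ![1, 1, 3, 1, -3]
  rw [star_trivial, keptScrewMatrix_singleton_quadForm Nat.prime_five, screwMatrix_five_quadForm] at hq
  have hsum : (∑ i : Fin 5, (![(1 : ℝ), 1, 3, 1, -3] i)) = 3 := by
    simp [Fin.sum_univ_five]; norm_num
  have htop : (∑ i : Fin 5, if (i : ℕ) + 1 = 5 then ![(1 : ℝ), 1, 3, 1, -3] i else 0) = -3 := by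
    simp [Fin.sum_univ_five]
  rw [hsum, htop] at hq
  obtain ⟨l21, h21⟩ := mem_uR_utab127 (a := 2) (b := 1) (by norm_num) (by norm_num) (by norm_num)
  obtain ⟨l31, h31⟩ := mem_uR_utab127 (a := 3) (b := 1) (by norm_num) (by norm_num) (by norm_num)
  obtain ⟨l41, h41⟩ := mem_uR_utab127 (a := 4) (b := 1) (by norm_num) (by norm_num) (by norm_num)
  obtain ⟨l51, h51⟩ := mem_uR_utab127 (a := 5) (b := 1) (by norm_num) (by norm_num) (by norm_num)
  obtain ⟨l61, h61⟩ := mem_uR_utab127 (a := 6) (b := 1) (by norm_num) (by norm_num) (by norm_num)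
  obtain ⟨l32, h32⟩ := mem_uR_utab127 (a := 3) (b := 2) (by norm_num) (by norm_num) (by norm_num)
  obtain ⟨l42, h42⟩ := mem_uR_utab127 (a := 4) (b := 2) (by norm_num) (by norm_num) (by norm_num)
  obtain ⟨l52, h52⟩ := mem_uR_utab127 (a := 5) (b := 2) (by norm_num) (by norm_num) (by norm_num)
  obtain ⟨l62, h62⟩ := mem_uR_utab127 (a := 6) (b := 2) (by norm_num) (by norm_num) (by norm_num)
  obtain ⟨l43, h43⟩ := mem_uR_utab127 (a := 4) (b := 3) (by norm_num) (by norm_num) (by norm_num)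
  obtain ⟨l53, h53⟩ := mem_uR_utab127 (a := 5) (b := 3) (by norm_num) (by norm_num) (by norm_num)
  obtain ⟨l63, h63⟩ := mem_uR_utab127 (a := 6) (b := 3) (by norm_num) (by norm_num) (by norm_num)
  obtain ⟨l54, h54⟩ := mem_uR_utab127 (a := 5) (b := 4) (by norm_num) (by norm_num) (by norm_num)
  obtain ⟨l64, h64⟩ := mem_uR_utab127 (a := 6) (b := 4) (by norm_num) (by norm_num) (by norm_num)
  obtain ⟨l65, h65⟩ := mem_uR_utab127 (a := 6) (b := 5) (by norm_num) (by norm_num) (by norm_num)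
  have plo := bumpWeight_five_lower
  have hChi : lerchC ≤ ((cHiQ : ℚ) : ℝ) := lerchC_le_cHiQ
  have hSC : (0 : ℝ) < ((SC : ℕ) : ℝ) := SC_pos
  have hltr := (Rat.cast_lt (K := ℝ)).2 witness5CheckQ
  push_cast at hltr
  set C := lerchC
  set s := ((SC : ℕ) : ℝ)
  set φ := bumpWeight 5
  have hCs_hi : C * s ≤ ((cHiQ : ℚ) : ℝ) * s := mul_le_mul_of_nonneg_right hChi hSC.le
  have hφs_lo : 13122 * s / 100000 ≤ φ * s := by
    have := mul_le_mul_of_nonneg_right plo hSC.le; linarith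
  have hnn := mul_nonneg hq hSC.le
  have expand : (15 / 2 * C + 6 * uR 2 1 + 6 * uR 3 1 + 18 * uR 4 1 + 6 * uR 5 1 - 18 * uR 6 1
      - 2 * (uR 3 2 + 3 * uR 4 2 + uR 5 2 - 3 * uR 6 2 + 3 * uR 4 3 + uR 5 3 - 3 * uR 6 3
        + 3 * uR 5 4 - 9 * uR 6 4 - 3 * uR 6 5) + 2 * φ * (-3) * 3) * s
      = 15 / 2 * (C * s) + 6 * (uR 2 1 * s) + 6 * (uR 3 1 * s) + 18 * (uR 4 1 * s) + 6 * (uR 5 1 * s)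
        - 18 * (uR 6 1 * s)
        - 2 * ((uR 3 2 * s) + 3 * (uR 4 2 * s) + (uR 5 2 * s) - 3 * (uR 6 2 * s) + 3 * (uR 4 3 * s)
          + (uR 5 3 * s) - 3 * (uR 6 3 * s) + 3 * (uR 5 4 * s) - 9 * (uR 6 4 * s) - 3 * (uR 6 5 * s))
        - 18 * (φ * s) := by ring
  rw [expand] at hnn
  linarith

/-- **CALIBRATION PIN at `p = 5` (RH-free, kernel):** `f((log 5)/2) ≤ 5`. [folklore] -/
theorem uniformWSTransfer_pin_five {f : ℝ → ℕ} (hT : UniformWSTransfer f) : f (Real.log 5 / 2) ≤ 5 := by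
  have h := uniformWSTransfer_pin hT Nat.prime_five (by norm_num) keptScrewMatrix_five_not_posSemidef
  exact_mod_cast h

/-! ### `p = 7`: witness `x = (1,1,0,0,2,0,−2)` on the nodes `log 2 … log 8`, `Q_D(x) ≈ 0.5393 − 8φ₇ ≈ −0.246`. -/

/-- `φ₇ = (log 7/√7)(log 8 − log 7) ≥ 0.0982`. [folklore] -/
theorem bumpWeight_seven_lower : (0.0982 : ℝ) ≤ bumpWeight 7 := by
  obtain ⟨hl2, _⟩ := log_two_bounds
  obtain ⟨hl7, hl7'⟩ := log_seven_bounds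
  have hΛ : (ArithmeticFunction.vonMangoldt 7 : ℝ) = Real.log 7 := by
    rw [ArithmeticFunction.vonMangoldt_apply_prime (by norm_num)]; norm_num
  have h8 : Real.log ((7 : ℕ) + 1 : ℝ) = 3 * Real.log 2 := by
    rw [show ((7 : ℕ) + 1 : ℝ) = 2 ^ 3 by norm_num, Real.log_pow]; norm_num
  rw [bumpWeight, hΛ, h8]
  push_cast
  set s := Real.sqrt 7 with hs
  have hs2 : s ^ 2 = 7 := Real.sq_sqrt (by norm_num)
  have hs0 : 0 < s := Real.sqrt_pos.mpr (by norm_num)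
  have hshi : s < (2.6457514 : ℝ) := by nlinarith
  rw [div_mul_eq_mul_div, le_div_iff₀ hs0]
  have hA : 0 ≤ (Real.log 7 - 1.9459101490551) * (3 * Real.log 2 - Real.log 7 - 0.1335313) :=
    mul_nonneg (by linarith) (by linarith)
  nlinarith

/-- ζ's part of the form at `x = (1,1,0,0,2,0,−2)` on `log 2 … log 8`, in table coordinates. [folklore] -/
theorem screwMatrix_seven_quadForm :
    dotProduct ![(1 : ℝ), 1, 0, 0, 2, 0, -2] ((screwMatrix 7).mulVec ![1, 1, 0, 0, 2, 0, -2]) =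
      7 / 2 * lerchC + 4 * uR 2 1 + 4 * uR 3 1 + 8 * uR 6 1 - 8 * uR 8 1
        - 2 * uR 3 2 - 4 * uR 6 2 + 4 * uR 8 2 - 4 * uR 6 3 + 4 * uR 8 3 + 8 * uR 8 6 := by
  rw [screwMatrix_eq_tMat]
  simp [dotProduct, Matrix.mulVec, Fin.sum_univ_seven, tMat, Matrix.of_apply]
  norm_num
  ring

/-- The kernel decision for `p = 7` (ℚ, scale `SC`; `φ₇ ≥ 0.0982`). [folklore] -/
theorem witness7CheckQ :
    7 / 2 * (cHiQ * (SC : ℚ)) + 4 * ((ug utab127 2 1).hi : ℚ) + 4 * ((ug utab127 3 1).hi : ℚ)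
      + 8 * ((ug utab127 6 1).hi : ℚ) - 8 * ((ug utab127 8 1).lo : ℚ)
      - 2 * ((ug utab127 3 2).lo : ℚ) - 4 * ((ug utab127 6 2).lo : ℚ) + 4 * ((ug utab127 8 2).hi : ℚ)
      - 4 * ((ug utab127 6 3).lo : ℚ) + 4 * ((ug utab127 8 3).hi : ℚ) + 8 * ((ug utab127 8 6).hi : ℚ)
      - 8 * (982 * (SC : ℚ) / 10000) < 0 := by
  decide +kernel

/-- **DETECTION AT THE FLOOR `p₁ = 7` (RH-FREE certified inequality):** `S_8(ζ_{ℙ∖{7}})` takes the value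
`≈ −0.246` at `x = (1,1,0,0,2,0,−2)`; `M₀(ℙ∖{7}) = 8`. [folklore] -/
theorem keptScrewMatrix_seven_not_posSemidef : ¬ (keptScrewMatrix {7} 7).PosSemidef := by
  intro hM
  have hq := hM.dotProduct_mulVec_nonneg ![1, 1, 0, 0, 2, 0, -2]
  rw [star_trivial, keptScrewMatrix_singleton_quadForm (by norm_num : Nat.Prime 7),
    screwMatrix_seven_quadForm] at hq
  have hsum : (∑ i : Fin 7, (![(1 : ℝ), 1, 0, 0, 2, 0, -2] i)) = 2 := by
    simp [Fin.sum_univ_seven]; norm_num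
  have htop : (∑ i : Fin 7, if (i : ℕ) + 1 = 7 then ![(1 : ℝ), 1, 0, 0, 2, 0, -2] i else 0) = -2 := by
    simp [Fin.sum_univ_seven]
  rw [hsum, htop] at hq
  obtain ⟨l21, h21⟩ := mem_uR_utab127 (a := 2) (b := 1) (by norm_num) (by norm_num) (by norm_num)
  obtain ⟨l31, h31⟩ := mem_uR_utab127 (a := 3) (b := 1) (by norm_num) (by norm_num) (by norm_num)
  obtain ⟨l61, h61⟩ := mem_uR_utab127 (a := 6) (b := 1) (by norm_num) (by norm_num) (by norm_num)
  obtain ⟨l81, h81⟩ := mem_uR_utab127 (a := 8) (b := 1) (by norm_num) (by norm_num) (by norm_num)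
  obtain ⟨l32, h32⟩ := mem_uR_utab127 (a := 3) (b := 2) (by norm_num) (by norm_num) (by norm_num)
  obtain ⟨l62, h62⟩ := mem_uR_utab127 (a := 6) (b := 2) (by norm_num) (by norm_num) (by norm_num)
  obtain ⟨l82, h82⟩ := mem_uR_utab127 (a := 8) (b := 2) (by norm_num) (by norm_num) (by norm_num)
  obtain ⟨l63, h63⟩ := mem_uR_utab127 (a := 6) (b := 3) (by norm_num) (by norm_num) (by norm_num)
  obtain ⟨l83, h83⟩ := mem_uR_utab127 (a := 8) (b := 3) (by norm_num) (by norm_num) (by norm_num)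
  obtain ⟨l86, h86⟩ := mem_uR_utab127 (a := 8) (b := 6) (by norm_num) (by norm_num) (by norm_num)
  have plo := bumpWeight_seven_lower
  have hChi : lerchC ≤ ((cHiQ : ℚ) : ℝ) := lerchC_le_cHiQ
  have hSC : (0 : ℝ) < ((SC : ℕ) : ℝ) := SC_pos
  have hltr := (Rat.cast_lt (K := ℝ)).2 witness7CheckQ
  push_cast at hltr
  set C := lerchC
  set s := ((SC : ℕ) : ℝ)
  set φ := bumpWeight 7
  have hCs_hi : C * s ≤ ((cHiQ : ℚ) : ℝ) * s := mul_le_mul_of_nonneg_right hChi hSC.le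
  have hφs_lo : 982 * s / 10000 ≤ φ * s := by
    have := mul_le_mul_of_nonneg_right plo hSC.le; linarith
  have hnn := mul_nonneg hq hSC.le
  have expand : (7 / 2 * C + 4 * uR 2 1 + 4 * uR 3 1 + 8 * uR 6 1 - 8 * uR 8 1
      - 2 * uR 3 2 - 4 * uR 6 2 + 4 * uR 8 2 - 4 * uR 6 3 + 4 * uR 8 3 + 8 * uR 8 6
      + 2 * φ * (-2) * 2) * s
      = 7 / 2 * (C * s) + 4 * (uR 2 1 * s) + 4 * (uR 3 1 * s) + 8 * (uR 6 1 * s) - 8 * (uR 8 1 * s)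
        - 2 * (uR 3 2 * s) - 4 * (uR 6 2 * s) + 4 * (uR 8 2 * s) - 4 * (uR 6 3 * s) + 4 * (uR 8 3 * s)
        + 8 * (uR 8 6 * s) - 8 * (φ * s) := by ring
  rw [expand] at hnn
  linarith

/-- **CALIBRATION PIN at `p = 7` (RH-free, kernel):** `f((log 7)/2) ≤ 7`. [folklore] -/
theorem uniformWSTransfer_pin_seven {f : ℝ → ℕ} (hT : UniformWSTransfer f) : f (Real.log 7 / 2) ≤ 7 := by
  have h := uniformWSTransfer_pin hT (by norm_num : Nat.Prime 7) le_rfl keptScrewMatrix_seven_not_posSemidef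
  exact_mod_cast h

/-- **THE KERNEL PIN TABLE (RH-free):** every W→S transfer uniform over the kept class satisfies
`f((log p)/2) ≤ p = e^{2a}` at `p = 2, 3, 5, 7` — the tree's `f(a) = ⌊e^{2a}⌋` is not improvable at any prime
window inside the banked Weil range. [folklore] -/
theorem uniformWSTransfer_pin_table {f : ℝ → ℕ} (hT : UniformWSTransfer f) :
    f (Real.log 2 / 2) ≤ 2 ∧ f (Real.log 3 / 2) ≤ 3 ∧ f (Real.log 5 / 2) ≤ 5 ∧ f (Real.log 7 / 2) ≤ 7 :=
  ⟨uniformWSTransfer_pin_two hT, uniformWSTransfer_pin_three hT, uniformWSTransfer_pin_five hT,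
    uniformWSTransfer_pin_seven hT⟩

end RhIdea6.G14.Transfer
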